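import Literature.NumberTheory.Automorphic.UnitaryFormGroupUnimodular        -- ★ `unitaryGroupOfForm` over `ℂ`, `mem_unitaryGroupOfForm_iff`
import Literature.GroupTheory.ArithmeticGroups.UnitaryRealApproximationGL    -- ★ `isEmbedding_coe_GL` (`GL_n(ℂ) → M_n(ℂ)` is an embedding)
import Mathlib.Topology.TietzeExtension
import Mathlib.Analysis.Complex.Tietze
import Mathlib.LinearAlgebra.Matrix.NonsingularInverse
import Mathlib.Topology.Instances.Matrix
import Mathlib.Topology.UrysohnsLemma
import HarnessLib

/-!
# Compactly supported continuous functions on `U(⋆, H)(ℂ)` are restrictions of compactly supported continuous functions on `M_n(ℂ)`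
# (Tietze extension along the closed embedding `U(⋆, H)(ℂ) ↪ M_n(ℂ)`; Deitmar–Echterhoff 2014 Lemma 9.3.3; Rogawski 1990 §8.3)

Topic `NumberTheory/Automorphic`; namespace `Literature.NumberTheory.Automorphic.UnitaryGroup`.  THEOREMS ONLY (no `def`, no instance, no notation, no axiom, no
`sorry`).  Cell `pub/hodgecm-mathlib`, crux H413 (`stmt-HodgeConjecture-24833`), F0∕P3c line LH3 (closer stub `stub_N9`, DIRECT ROAD), organ J; brick **(EXT)** of the
H-SIDE HEAD (LH10-p02 (g4)).  Count-neutral.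

WHY.  The product test functions of ★ (N1) `exists_archSmooth₂_prod` (LH2-p04) come with local factors `f_w : U(Φ₂)_w → ℝ` on the GROUP, while the rank-one jump and
cone letters ★ (K0±-Cayley) `exists_hasOneSidedJump_two_sin_mul_orbitalIntegral_cayley`, ★ (A0-c) and ★ (J-H) `exists_hasOneSidedJump_stOrbFamH_add_smul_nrm_prod` read the
`w₀`-factor as the restriction `f₀ ∘ coe` of a continuous compactly supported `f₀` on `M₂(ℂ)` (their cone integrals evaluate `f₀` at explicit matrices).  This file closes the
gap once and for all: every continuous compactly supported real function on `U(⋆, H)(ℂ)` (`H` non-degenerate) IS such a restriction.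

THE MATHEMATICS.  `ι : U(⋆, H)(ℂ) → M_n(ℂ)`, `g ↦ g`, is a CLOSED EMBEDDING: an embedding because `GL_n(ℂ) → M_n(ℂ)` is one (★ `isEmbedding_coe_GL`: inversion is continuous on the
invertible matrices) and `U(⋆, H)(ℂ) ≤ GL_n(ℂ)` carries the subspace topology; closed range because `range ι = {X ∣ X̄ᵀ H X = H}` — a matrix satisfying the
unitarity equation is automatically invertible when `det H ≠ 0` (`det X̄ · det H · det X = det H`).  Tietze (Mathlib `ContinuousMap.exists_extension'`, `ℝ` is a Tietze
space, `M_n(ℂ)` is normal) extends `f` to a continuous `G` on `M_n(ℂ)` with `G ∘ ι = f`; a Urysohn cut-off `χ ∈ C_c(M_n(ℂ))` equal to `1` on the compact `ι(tsupport f)`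
(Mathlib `exists_continuous_one_zero_of_isCompact`) gives `F = χ · G ∈ C_c(M_n(ℂ))` with `F ∘ ι = f` everywhere (on `tsupport f` because `χ = 1` there, off it because
`G ∘ ι = f = 0` there).
HONEST LABEL: HC_CM is proved only modulo the 7 printed citations (2 remaining: hLiu418 = `stmt-HodgeConjecture-24832`, h413 = `stmt-HodgeConjecture-24833`) until rung 0
closes; point-set topology over Mathlib, moves no row of the books.

## References
* [DeitmarEchterhoff2014] A. Deitmar, S. Echterhoff, *Principles of Harmonic Analysis*, 2nd ed. (2014), Lemma 9.3.3 (matrix groups are closed in `M_n`), App. A.8 (Tietze, Urysohn).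
* [Rogawski1990] J. D. Rogawski, *Automorphic Representations of Unitary Groups in Three Variables*, Ann. of Math. Stud. 123 (1990), §3.1 p. 19, §8.3 p. 122 (test functions on
  `U(Φ₂)(ℂ)`).
* [Folland1995] G. B. Folland, *A Course in Abstract Harmonic Analysis* (1995), §2.2 (compactly supported functions on locally compact groups).
-/

set_option autoImplicit false

noncomputable section

open Set Filter Topology
open scoped MatrixGroups Matrix ComplexConjugate

namespace Literature.NumberTheory.Automorphic.UnitaryGroup

section Extension

variable {n : Type*} [Fintype n] [DecidableEq n]

/-- **The range of `U(⋆, H)(ℂ) → M_n(ℂ)` is the solution set of the unitarity equation** `{X ∣ X̄ᵀ H X = H}` when `det H ≠ 0` (a solution is automatically invertible: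
`det X̄ · det H · det X = det H`). [cite: DeitmarEchterhoff2014, Lemma 9.3.3] [cite: Rogawski1990, §3.1 p. 19] -/
theorem range_coe_unitaryGroupOfForm_eq (H : Matrix n n ℂ) (hH : H.det ≠ 0) :
    Set.range (fun g : ↥(unitaryGroupOfForm (starRingEnd ℂ) H) => ((g : GL n ℂ) : Matrix n n ℂ)) =
      {X : Matrix n n ℂ | (X.map (starRingEnd ℂ))ᵀ * H * X = H} := by
  ext X
  constructor
  · rintro ⟨g, rfl⟩
    exact mem_unitaryGroupOfForm_iff.1 g.2
  · intro hX
    have hdet : X.det ≠ 0 := by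
      intro h0
      have h := congrArg Matrix.det hX
      rw [Matrix.det_mul, Matrix.det_mul, h0, mul_zero] at h
      exact hH h.symm
    refine ⟨⟨Matrix.GeneralLinearGroup.mkOfDetNeZero X hdet, mem_unitaryGroupOfForm_iff.2 ?_⟩, rfl⟩
    simpa only [Matrix.GeneralLinearGroup.val_mkOfDetNeZero, Set.mem_setOf_eq] using hX

/-- **`U(⋆, H)(ℂ) → M_n(ℂ)` has closed range** (`det H ≠ 0`). [cite: DeitmarEchterhoff2014, Lemma 9.3.3] -/
theorem isClosed_range_coe_unitaryGroupOfForm (H : Matrix n n ℂ) (hH : H.det ≠ 0) :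
    IsClosed (Set.range (fun g : ↥(unitaryGroupOfForm (starRingEnd ℂ) H) => ((g : GL n ℂ) : Matrix n n ℂ))) := by
  rw [range_coe_unitaryGroupOfForm_eq H hH]
  exact isClosed_eq (((continuous_id.matrix_map Complex.continuous_conj).matrix_transpose.mul continuous_const).mul continuous_id) continuous_const

/-- **`U(⋆, H)(ℂ) → M_n(ℂ)` is a CLOSED EMBEDDING** (`det H ≠ 0`): `GL_n(ℂ) → M_n(ℂ)` is an embedding and the subgroup carries the subspace topology; the range is closed.
[cite: DeitmarEchterhoff2014, Lemma 9.3.3] [cite: Folland1995, §2.2] -/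
theorem isClosedEmbedding_coe_unitaryGroupOfForm (H : Matrix n n ℂ) (hH : H.det ≠ 0) :
    IsClosedEmbedding (fun g : ↥(unitaryGroupOfForm (starRingEnd ℂ) H) => ((g : GL n ℂ) : Matrix n n ℂ)) :=
  ⟨Literature.GroupTheory.ArithmeticGroups.RealApproximation.isEmbedding_coe_GL.comp IsEmbedding.subtypeVal, isClosed_range_coe_unitaryGroupOfForm H hH⟩

/-- **(EXT) EVERY CONTINUOUS COMPACTLY SUPPORTED REAL FUNCTION ON `U(⋆, H)(ℂ)` IS THE RESTRICTION OF ONE ON `M_n(ℂ)`** (`det H ≠ 0`): there is `F : M_n(ℂ) → ℝ`, continuous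
with compact support, with `F(g) = f(g)` for every `g ∈ U(⋆, H)(ℂ)` — Tietze along the closed embedding, then a Urysohn cut-off equal to `1` on the image of `tsupport f`.
[cite: DeitmarEchterhoff2014, Lemma 9.3.3; App. A.8] [cite: Folland1995, §2.2] [cite: Rogawski1990, §8.3 p. 122] -/
theorem exists_hasCompactSupport_extend (H : Matrix n n ℂ) (hH : H.det ≠ 0)
    (f : ↥(unitaryGroupOfForm (starRingEnd ℂ) H) → ℝ) (hf : Continuous f) (hfc : HasCompactSupport f) :
    ∃ F : Matrix n n ℂ → ℝ, Continuous F ∧ HasCompactSupport F ∧ ∀ g : ↥(unitaryGroupOfForm (starRingEnd ℂ) H), F ((g : GL n ℂ) : Matrix n n ℂ) = f g := by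
  haveI : LocallyCompactSpace (Matrix n n ℂ) := (inferInstance : LocallyCompactSpace (n → n → ℂ))
  haveI : NormalSpace (Matrix n n ℂ) := (inferInstance : NormalSpace (n → n → ℂ))
  have he := isClosedEmbedding_coe_unitaryGroupOfForm H hH
  -- Tietze: a continuous extension `G` with `G ∘ ι = f`
  obtain ⟨G, hG⟩ := ContinuousMap.exists_extension' he (⟨f, hf⟩ : C(↥(unitaryGroupOfForm (starRingEnd ℂ) H), ℝ))
  have hGf : ∀ g : ↥(unitaryGroupOfForm (starRingEnd ℂ) H), G ((g : GL n ℂ) : Matrix n n ℂ) = f g := fun g => congrFun hG g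
  -- Urysohn cut-off equal to `1` on the compact image of the support
  have hK : IsCompact ((fun g : ↥(unitaryGroupOfForm (starRingEnd ℂ) H) => ((g : GL n ℂ) : Matrix n n ℂ)) '' tsupport f) := hfc.image he.continuous
  obtain ⟨χ, hχ1, -, hχc, -⟩ := exists_continuous_one_zero_of_isCompact hK isClosed_empty (Set.disjoint_empty _)
  refine ⟨fun X => χ X * G X, χ.continuous.mul G.continuous, hχc.mul_right, fun g => ?_⟩
  change χ ((g : GL n ℂ) : Matrix n n ℂ) * G ((g : GL n ℂ) : Matrix n n ℂ) = f g
  by_cases hg : g ∈ tsupport f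
  · have h1 : χ ((g : GL n ℂ) : Matrix n n ℂ) = 1 := hχ1 ⟨g, hg, rfl⟩
    rw [h1, one_mul, hGf]
  · rw [hGf, image_eq_zero_of_notMem_tsupport hg, mul_zero]

end Extension

end Literature.NumberTheory.Automorphic.UnitaryGroup

end
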